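import Summits.BirchSwinnertonDyer.BirchSwinnertonDyer.Theorems.PrintCf2SplitBadTwoKummerTorsionH1
import Summits.BirchSwinnertonDyer.BirchSwinnertonDyer.Theorems.PrintCf2SplitBadTwoUnrSelmerTwistDivisibleOfAmbient
import Literature.NumberTheory.EllipticCurves.GreenbergVatsal2000.UnramifiedOutsideFinite
import Literature.NumberTheory.EllipticCurves.ZpExtensionDescentProofs
import Literature.NumberTheory.EllipticCurves.IwasawaNakayamaProofs
import HarnessLib

/-!
# The canonical `Λ`-dual of the unramified ambient `H_nr(K_∞, M) = unramifiedOutside (ker κ) M p S₀`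
# over ANY `ℤ_p`-line is finitely generated, for a `p`-divisible cofinite-type module `M`
# (helper for crux stmt-BirchSwinnertonDyer-20368 `PrintCf2.SplitBadTwoRankOneOfFacts`; cell `bsd-print-cf2`,
# seat `bsd-line-cf2-p1-w7` g5, file 10 — the finite-generation half of leaf (ii)_nr of file 8)

Greenberg LNM 1716 p. 117 L1 («`X` = the Pontryagin dual of `H¹(F_Σ/F_∞, 𝒜)` is a finitely generated
`Λ`-module») for a GENERAL discrete module: `K` any number field, `κ` ANY `ℤ_p`-extension with
topological generator `γ`, `M` a discrete `Γ_K`-module which is `p`-primary, `p`-DIVISIBLE, with finite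
`M[p^n]`, open stabilisers, and inertia acting trivially outside a finite set `S_M` of places.  The
argument is the tree's `H1SigmaDualFiniteProofs` (bsd-2adic t42, for `E[p^∞]`) run on the generic
Kummer lemmas of file 9 (`KummerTorsion.*`):

* §1 `finite_setOf_unramifiedOutside_pTorsion_conjH1_eq` — `H_nr(K_∞, M)[𝔪] = {c unramified outside
  S₀ ∪ {p}, p c = 0, conj_γ c = c}` is FINITE: Kummer lift `c = ι y`, `y ∈ H¹(K_∞, M[p])` (file 9 (A));
  `conj_γ y − y ∈ ker ι` (finite, file 9 §2); the classes `y` are unramified outside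
  `S' = S₀ ∪ S_M ∪ {p}` AS `M[p]`-VALUED classes (at `w ∉ S'` the inertia group acts trivially on `M`,
  so `H¹(I, M[p]) → H¹(I, M)` is injective, file 9 §3 — no transport to other primes is needed, the
  Greenberg–Vatsal condition being imposed at all conjugates); the `γ`-INVARIANT ones descend to
  `H¹(Γ_K, M[p])` (`ZpDescent.exists_resSubgroup_eq_of_conjH1_eq`) and are unramified there
  (-w6 g4's transfer `LineTransport.resOfLe_mem_unramifiedOutside_iff_of_inf_inertia_le` along
  `ker κ ≤ ⊤`, `I_w ≤ ker κ` for `w ∤ p`), hence finite (`GreenbergVatsal2000.finite_setOf_mem_unramifiedOutside`,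
  Silverman X.4.3 / Hermite); translates finish.
* §2 `module_finite_of_dualData_unramifiedOutside` — hence EVERY Pontryagin-dual datum `(Y, dY)` of
  `H_nr(K_∞, M)` (`T ↦ conj_γ − 1`, constants through `ℤ_p → ℤ/p^k`) is finitely generated over `Λ`
  (`IwasawaDual.IsDualPair.module_finite`, dual Nakayama; local nilpotence by -w4 g8's
  `isLocNil_conjAmbient_sub_one`).
* (file 11 discharges the hypotheses for `A_θ = KellerYin2024.charModule ∅ θ`, `θ` of finite order, and
  re-derives S3n′ with leaf (ii)_nr shortened to «no nonzero finite `Λ`-submodule».)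

HONEST FRAMING: closes nothing by itself (`--supports`); removes the «finitely generated» conjunct from
leaf (ii)_nr of file 8.  No named fact, no definition, no `sorry`.  No summit statement is proved by this
file; BSD is not proved by any of this.

References: Greenberg LNM 1716 §1 p. 60, §3 Lemma 3.1, §4 p. 117; Silverman AEC X.4.3; Serre,
*Abelian ℓ-adic representations* I §2.1; Lang, *Cyclotomic Fields* Ch. 5 §1.
-/

-- the summit namespace `Summit.BirchSwinnertonDyer.BirchSwinnertonDyer` repeats the problem name by design (D-0017)
set_option linter.dupNamespace false
set_option autoImplicit false

noncomputable section

open scoped Classical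
open CategoryTheory NumberField IsDedekindDomain Field
open Literature.NumberTheory.EllipticCurves Literature.NumberTheory.EllipticCurves.GreenbergSelmer
open Literature.NumberTheory.EllipticCurves.GreenbergVatsal2000
open Literature.NumberTheory.GaloisRepresentations
open Summit.BirchSwinnertonDyer.BirchSwinnertonDyer.Theorems.PrintCf2

namespace Summit.BirchSwinnertonDyer.BirchSwinnertonDyer.Theorems.PrintCf2.UnramifiedDual

/-! ## §1. `H_nr(K_∞, M)[𝔪]` is finite -/

section Generic

variable {K : Type} [Field K] [NumberField K] {p : ℕ} [Fact p.Prime] (κ : ZpExtension K p)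
  {M : Type} [AddCommGroup M] [DistribMulAction (absoluteGaloisGroup K) M] [TopologicalSpace M]
  [DiscreteTopology M]

/-- **`{c ∈ H_nr(K_∞, M) : p c = 0, conj_γ c = c}` is finite** for every `ℤ_p`-extension `κ` of a number
field `K` (topological generator `γ`), every finite `S₀`, and every discrete `Γ_K`-module `M` which is
`p`-primary, `p`-divisible, with finite `M[p^n]`, open stabilisers, and inertia acting trivially outside a
finite set `S_M` of places (Greenberg LNM 1716 p. 117 L1 / §1 p. 60 «`X/𝔪X` is finite», for a general
module; proof in the module docstring, §1). [cite: GreenbergLNM1716, §1 p. 60 and §4 p. 117]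
[cite: SilvermanAEC2009, Lemma X.4.3] -/
theorem finite_setOf_unramifiedOutside_pTorsion_conjH1_eq {γ : absoluteGaloisGroup K}
    (hγ : κ.IsTopGenerator γ) (hdiv : ∀ a : M, ∃ b : M, p • b = a)
    (htors : ∀ m : M, ∃ n : ℕ, p ^ n • m = 0)
    (hfin : ∀ n : ℕ, Finite ↥(AddSubgroup.torsionBy M ((p ^ n : ℕ) : ℤ)))
    (hstab : ∀ m : M, IsOpen (MulAction.stabilizer (absoluteGaloisGroup K) m : Set (absoluteGaloisGroup K)))
    {SM : Set (HeightOneSpectrum (𝓞 K))} (hSM : SM.Finite)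
    (htrivI : ∀ v : HeightOneSpectrum (𝓞 K), v ∉ SM → ((p : ℕ) : 𝓞 K) ∉ v.asIdeal →
      ∀ τ ∈ GreenbergSelmer.inertia (K := K) v, ∀ m : M, τ • m = m)
    {S₀ : Set (HeightOneSpectrum (𝓞 K))} (hS₀ : S₀.Finite) :
    Set.Finite {c : subgroupH1 κ.kerSubgroup M |
      c ∈ unramifiedOutside κ.kerSubgroup M p S₀ ∧ p • c = 0 ∧ conjH1 κ.kerSubgroup M γ c = c} := by
  classical
  have hp := (Fact.out : p.Prime)
  -- notation
  let N := κ.kerSubgroup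
  let Mp : Type := ↥(AddSubgroup.torsionBy M (p : ℤ))
  let ι : subgroupH1 N Mp →+ subgroupH1 N M :=
    resH1Hom (ContinuousMonoidHom.id N) (AddSubgroup.torsionBy M (p : ℤ)).subtype (fun _ _ ↦ rfl)
  -- instances / elementary facts on `M` and `M[p]`
  haveI : ContinuousSMul (absoluteGaloisGroup K) M := continuousSMul_iff_stabilizer_isOpen.mpr hstab
  have hstabp : ∀ m : Mp, IsOpen (MulAction.stabilizer (absoluteGaloisGroup K) m :
      Set (absoluteGaloisGroup K)) := fun m ↦ by
    convert hstab (m : M) using 1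
    ext σ
    simp only [SetLike.mem_coe, MulAction.mem_stabilizer_iff]
    exact ⟨fun h ↦ congrArg Subtype.val h, fun h ↦ Subtype.ext h⟩
  haveI : ContinuousSMul (absoluteGaloisGroup K) Mp := continuousSMul_iff_stabilizer_isOpen.mpr hstabp
  haveI : Finite Mp := by
    have h1 := hfin 1
    rw [pow_one] at h1
    exact h1
  have hpM : ∀ v : Mp, p • v = 0 := fun v ↦ Subtype.ext (by
    rw [AddSubgroupClass.coe_nsmul, ZeroMemClass.coe_zero]
    exact AddSubgroup.torsionBy.nsmul_iff.mp v.2)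
  have hcontN : ∀ b : M, Continuous fun σ : N ↦ σ • b := fun b ↦ by
    have h : (fun σ : N ↦ σ • b) = (fun σ : absoluteGaloisGroup K ↦ σ • b) ∘ Subtype.val := by
      ext σ; rfl
    rw [h]
    exact (continuous_id.smul continuous_const).comp continuous_subtype_val
  -- the finite set of places `S' = S_M ∪ {v ∣ p} ∪ S₀`
  let S' : Set (HeightOneSpectrum (𝓞 K)) := (SM ∪ {v | ((p : ℤ) : 𝓞 K) ∈ v.asIdeal}) ∪ S₀
  have hS' : S'.Finite :=
    (hSM.union (WeierstrassCurve.finite_setOf_intCast_mem_asIdeal (by exact_mod_cast hp.ne_zero))).union hS₀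
  have hS'S₀ : ∀ v, v ∉ S' → v ∉ S₀ := fun v hv h ↦ hv (Or.inr h)
  have hS'SM : ∀ v, v ∉ S' → v ∉ SM := fun v hv h ↦ hv (Or.inl (Or.inl h))
  -- (D) the `γ`-invariant classes of `H¹(K_∞, M[p])` unramified outside `S'` are finite
  have hD : Set.Finite {y : subgroupH1 N Mp |
      conjH1 N Mp γ y = y ∧ y ∈ unramifiedOutside N Mp p S'} := by
    have hT : {c : subgroupH1 (⊤ : Subgroup (absoluteGaloisGroup K)) Mp |
        c ∈ unramifiedOutside ⊤ Mp p S'}.Finite :=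
      GreenbergVatsal2000.finite_setOf_mem_unramifiedOutside (H := ⊤) (by
        simp only [Subgroup.coe_top]; exact isOpen_univ) hp.ne_zero hS'
    have hcomp : (Literature.NumberTheory.EllipticCurves.resOfLe Mp
          (le_top : N ≤ (⊤ : Subgroup (absoluteGaloisGroup K)))).comp (ResKernel.resSubgroup ⊤ Mp) =
        ResKernel.resSubgroup N Mp := by
      unfold Literature.NumberTheory.EllipticCurves.resOfLe ResKernel.resSubgroup
      rw [resH1Hom_comp]
      exact resH1Hom_congr (ContinuousMonoidHom.ext fun _ ↦ rfl) (AddMonoidHom.ext fun _ ↦ rfl) _ _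
    refine (hT.image (Literature.NumberTheory.EllipticCurves.resOfLe Mp
      (le_top : N ≤ (⊤ : Subgroup (absoluteGaloisGroup K))))).subset ?_
    rintro y ⟨hyγ, hyU⟩
    obtain ⟨y₀, hy₀⟩ := ZpDescent.exists_resSubgroup_eq_of_conjH1_eq hγ hstabp hpM y hyγ
    have hy : Literature.NumberTheory.EllipticCurves.resOfLe Mp
        (le_top : N ≤ (⊤ : Subgroup (absoluteGaloisGroup K))) (ResKernel.resSubgroup ⊤ Mp y₀) = y := by
      rw [← AddMonoidHom.comp_apply, hcomp, hy₀]
    refine ⟨ResKernel.resSubgroup ⊤ Mp y₀, ?_, hy⟩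
    show ResKernel.resSubgroup ⊤ Mp y₀ ∈ unramifiedOutside ⊤ Mp p S'
    refine (LineTransport.resOfLe_mem_unramifiedOutside_iff_of_inf_inertia_le p S'
      (le_top : N ≤ (⊤ : Subgroup (absoluteGaloisGroup K))) (fun w _ hpw ↦ ?_)
      (ResKernel.resSubgroup ⊤ Mp y₀)).mp (by rw [hy]; exact hyU)
    exact inf_le_right.trans (IwasawaTwoVariable.inertia_le_kerSubgroup_of_not_mem κ hpw)
  -- (A) the kernel of the Kummer map is finite
  have hF₀ : Set.Finite ((ι.ker : AddSubgroup (subgroupH1 N Mp)) : Set (subgroupH1 N Mp)) :=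
    KummerTorsion.finite_ker_torsionToH1 N p hdiv htors hfin hcontN
  -- (U) unramified `M`-valued Kummer classes are unramified `M[p]`-valued classes outside `S'`
  have hUnr : ∀ y : subgroupH1 N Mp, ι y ∈ unramifiedOutside N M p S₀ →
      y ∈ unramifiedOutside N Mp p S' := by
    intro y hy
    rw [mem_unramifiedOutside_iff] at hy ⊢
    intro v hvS' hpv σ
    have h1 := hy v (hS'S₀ v hvS') hpv σ
    rw [KummerTorsion.conjH1_torsionToH1] at h1
    rw [GreenbergVatsal2000.unramifiedKer, AddMonoidHom.mem_ker] at h1 ⊢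
    have hnat : ∀ z : subgroupH1 N Mp,
        resH1Hom (inertiaInToH N v) (AddMonoidHom.id M) (fun _ _ ↦ rfl) (ι z) =
          resH1Hom (ContinuousMonoidHom.id ↥(inertiaIn N v)) (AddSubgroup.torsionBy M (p : ℤ)).subtype
            (fun _ _ ↦ rfl) (resH1Hom (inertiaInToH N v) (AddMonoidHom.id Mp) (fun _ _ ↦ rfl) z) := by
      intro z
      change ((resH1Hom (inertiaInToH N v) (AddMonoidHom.id M) (fun _ _ ↦ rfl)).comp ι) z =
        ((resH1Hom (ContinuousMonoidHom.id ↥(inertiaIn N v)) (AddSubgroup.torsionBy M (p : ℤ)).subtype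
          (fun _ _ ↦ rfl)).comp (resH1Hom (inertiaInToH N v) (AddMonoidHom.id Mp) (fun _ _ ↦ rfl))) z
      rw [resH1Hom_comp, resH1Hom_comp]
      exact congrArg (fun f : subgroupH1 N Mp →+ discreteH1 ↥(inertiaIn N v) M ↦ f z)
        (resH1Hom_congr (ContinuousMonoidHom.ext fun _ ↦ rfl) (AddMonoidHom.ext fun _ ↦ rfl) _ _)
    rw [hnat] at h1
    have hinj := KummerTorsion.torsionToH1_injective_of_forall_smul_eq (inertiaIn N v) p (M := M)
      (fun x m ↦ htrivI v (hS'SM v hvS') hpv _ ((mem_inertiaIn_iff N v x.1).mp x.2).2 m)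
    exact (injective_iff_map_eq_zero _).1 hinj _ h1
  -- (L) the Kummer lifts of the target classes form a finite set
  have hL : Set.Finite {y : subgroupH1 N Mp |
      ι y ∈ unramifiedOutside N M p S₀ ∧ conjH1 N M γ (ι y) = ι y} := by
    have hsub : {y : subgroupH1 N Mp | ι y ∈ unramifiedOutside N M p S₀ ∧ conjH1 N M γ (ι y) = ι y} ⊆
        ⋃ f ∈ (ι.ker : Set (subgroupH1 N Mp)),
          {y | y ∈ unramifiedOutside N Mp p S' ∧ conjH1 N Mp γ y - y = f} := by
      rintro y ⟨hy1, hy2⟩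
      simp only [Set.mem_iUnion, Set.mem_setOf_eq, SetLike.mem_coe, exists_prop]
      refine ⟨_, ?_, hUnr y hy1, rfl⟩
      rw [AddMonoidHom.mem_ker, map_sub, ← KummerTorsion.conjH1_torsionToH1, hy2, sub_self]
    refine (hF₀.biUnion fun f _ ↦ ?_).subset hsub
    by_cases hne : {y : subgroupH1 N Mp |
        y ∈ unramifiedOutside N Mp p S' ∧ conjH1 N Mp γ y - y = f}.Nonempty
    · obtain ⟨y₀, hy₀U, hy₀⟩ := hne
      refine (hD.image fun a ↦ y₀ + a).subset ?_
      rintro y ⟨hyU, hy⟩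
      refine ⟨y - y₀, ⟨?_, AddSubgroup.sub_mem _ hyU hy₀U⟩, add_sub_cancel y₀ y⟩
      rw [map_sub, sub_eq_iff_eq_add.mp hy, sub_eq_iff_eq_add.mp hy₀]
      abel
    · rw [Set.not_nonempty_iff_eq_empty.mp hne]
      exact Set.finite_empty
  -- conclusion: the target set lies in `ι '' L`
  refine (hL.image ι).subset ?_
  rintro c ⟨hcS, hpc, hcγ⟩
  obtain ⟨y, hy⟩ := KummerTorsion.exists_torsionToH1_eq N p hdiv hcontN hpc
  exact ⟨y, ⟨by rw [show ι y = c from hy]; exact hcS, by rw [show ι y = c from hy]; exact hcγ⟩, hy⟩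

/-! ## §2. Every Pontryagin-dual datum of `H_nr(K_∞, M)` is finitely generated over `Λ` -/

/-- **Every `Λ`-dual datum of the unramified ambient `H_nr(K_∞, M) = unramifiedOutside (ker κ) M p S₀`
is finitely generated** (same hypotheses as §1): `(Y, dY)` with `T ↦ conj_γ − 1` and constants through
`ℤ_p → ℤ/p^k` is an `IwasawaDual.IsDualPair` for `ψ = conj_γ| − 1` (locally nilpotent by -w4 g8's
`isLocNil_conjAmbient_sub_one`), and the dual Nakayama lemma `IsDualPair.module_finite` applies by §1.
[cite: GreenbergLNM1716, §1 p. 60 and §4 p. 117] [cite: Lang1990, Ch. 5 §1] -/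
theorem module_finite_of_dualData_unramifiedOutside {γ : absoluteGaloisGroup K}
    (hγ : κ.IsTopGenerator γ) (hdiv : ∀ a : M, ∃ b : M, p • b = a)
    (htors : ∀ m : M, ∃ n : ℕ, p ^ n • m = 0)
    (hfin : ∀ n : ℕ, Finite ↥(AddSubgroup.torsionBy M ((p ^ n : ℕ) : ℤ)))
    (hstab : ∀ m : M, IsOpen (MulAction.stabilizer (absoluteGaloisGroup K) m : Set (absoluteGaloisGroup K)))
    {SM : Set (HeightOneSpectrum (𝓞 K))} (hSM : SM.Finite)
    (htrivI : ∀ v : HeightOneSpectrum (𝓞 K), v ∉ SM → ((p : ℕ) : 𝓞 K) ∉ v.asIdeal →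
      ∀ τ ∈ GreenbergSelmer.inertia (K := K) v, ∀ m : M, τ • m = m)
    {S₀ : Set (HeightOneSpectrum (𝓞 K))} (hS₀ : S₀.Finite)
    {Y : Type*} [AddCommGroup Y] [Module (IwasawaAlgebra p) Y]
    (dY : Y →+ (↥(unramifiedOutside κ.kerSubgroup M p S₀) →+ AddCircle (1 : ℚ)))
    (hbij : Function.Bijective dY)
    (hTY : ∀ (y : Y) (c : ↥(unramifiedOutside κ.kerSubgroup M p S₀)),
      dY ((PowerSeries.X : IwasawaAlgebra p) • y) c =
        dY y ⟨conjH1 κ.kerSubgroup M γ c, conjH1_mem_unramifiedOutside κ.kerSubgroup M p S₀ γ c.2⟩ - dY y c)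
    (hCY : ∀ (a : ℤ_[p]) (y : Y) (c : ↥(unramifiedOutside κ.kerSubgroup M p S₀)) (k : ℕ), (p ^ k) • c = 0 →
      dY (PowerSeries.C a • y) c = (PadicInt.toZModPow k a).val • dY y c) :
    Module.Finite (IwasawaAlgebra p) Y := by
  -- the restricted conjugation and `ψ = φ − 1`
  let Hamb := unramifiedOutside κ.kerSubgroup M p S₀
  let φ : AddMonoid.End Hamb :=
    ((conjH1 κ.kerSubgroup M γ).restrict Hamb).codRestrict Hamb
      fun c ↦ conjH1_mem_unramifiedOutside κ.kerSubgroup M p S₀ γ c.2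
  let ψ : AddMonoid.End Hamb := φ - 1
  have hψ : ∀ c : Hamb, ((ψ c : Hamb) : subgroupH1 κ.kerSubgroup M) = conjH1 κ.kerSubgroup M γ c - c :=
    fun c ↦ by
    show ((((φ - 1) c : Hamb)) : subgroupH1 κ.kerSubgroup M) = _
    rw [IwasawaDual.End_sub_apply, AddMonoid.End.one_apply, AddSubgroup.coe_sub]
    rfl
  have hln :=
    Summit.BirchSwinnertonDyer.BirchSwinnertonDyer.Theorems.PrintCf2.RestrictedSelmerPair.isLocNil_conjAmbient_sub_one
      htors hstab hγ ψ hψ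
  have hpair : IwasawaDual.IsDualPair p ψ dY :=
    { bijective := hbij
      T_smul := fun y s ↦ by
        rw [hTY, ← map_sub]
        exact congrArg (dY y) (Subtype.ext (by rw [hψ, AddSubgroup.coe_sub]))
      C_smul := hCY
      locNil := hln }
  refine hpair.module_finite ?_
  refine ((finite_setOf_unramifiedOutside_pTorsion_conjH1_eq κ hγ hdiv htors hfin hstab hSM htrivI
    hS₀).preimage (Subtype.val_injective.injOn)).subset ?_
  intro s hs
  obtain ⟨hs1, hs2⟩ := hs
  rw [pow_one] at hs1 hs2
  rw [IwasawaDual.End_sub_apply, AddMonoid.End.one_apply, sub_eq_zero] at hs2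
  refine ⟨s.2, ?_, ?_⟩
  · have h1 := congrArg (fun z : Hamb ↦ (z : subgroupH1 κ.kerSubgroup M)) hs1
    simpa using h1
  · have h2 := congrArg (fun z : Hamb ↦ (z : subgroupH1 κ.kerSubgroup M)) hs2
    exact h2

end Generic

end Summit.BirchSwinnertonDyer.BirchSwinnertonDyer.Theorems.PrintCf2.UnramifiedDual

end
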